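import Literature.Computability.MetaComplexity.GapMINKTDenseRandomNPProofs
import Literature.Computability.FineGrained.SATBruteForceCount
import Literature.Computability.Complexity.FoldBricks
import Literature.Computability.Complexity.FPStringBricks
import Literature.Computability.Complexity.StackBricksStrings
import Mathlib.Data.Int.CardIntervalMod
import HarnessLib

/-!
# Hirahara's Cor. 4.22 (1 ⇒ 2) (proofs): `DistNP ⊆ AvgP ⟹ (MINKT[n-1], 𝒟^KT) ∈ Avg_{1/6m}P`

Third sibling proof file of `GapMINKTDenseRandom.lean` (D-0014: named facts `def X : Prop` are
discharged as `theorem X_holds : X`; the first, `GapMINKTDenseRandomProofs.lean`, discharges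
Lemma 4.17 and the second, `GapMINKTDenseRandomNPProofs.lean`, Fact 4.15). It DISCHARGES
`Hirahara2018_MINKTr_DKT_mem_AvgDeltaP` (Hirahara, FOCS 2018; full version ECCC TR18-138 rev. 1,
whose numbering is cited), **Cor. 4.22 (1 ⇒ 2)**: *if `DistNP ⊆ AvgP` then
`(MINKT[r], 𝒟^KT) ∈ Avg_{1/6m}P` for `r(n) = n - 1`.* In print (p. 23): "For `r(n) := n − 1`, we
have `(MINKT[r], 𝒟^KT) ∈ DistNP ⊆ AvgP ⊆ Avg_{1/6m}P`" (Fact 4.15, Def. 4.16).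

## The printed one-liner under the tree's conventions

The tree's `PSamp` (`DistProblems.lean`, Bogdanov–Trevisan Def. 2.1) asks for an **exact** sampler
with a polynomial coin budget, so output probabilities are dyadic, whereas `𝒟^KT_m` (Def. 4.13: pick
`n ∈_R [m]`, `x ∈_R {0,1}ⁿ`, output `(x, 1^{m-n})`) has point masses `2^{-n}/m`; thus
`(MINKT[r], 𝒟^KT) ∈ DistNP` fails verbatim and the implication is proved through a dominating
ensemble (as announced in the module docstring of `GapMINKTDenseRandom.lean`, "Samplability"):

1. `exists_sampler_mem_FP`: an `FP` string function `S` which on `⟨1ᵐ, r⟩` with `2m` coins `r`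
   selects `n - 1 := ⟦r↾m⟧ mod m` (the first `m` coins as a binary numeral modulo `m`) and outputs
   `(x, 1^{m-n})` with `x` the next `n` coins — a composition of existing bricks (`padTakeFn`,
   `lenBinF`, `remFn`, `addFn`, `binToUnaryFn`); its output law `D'_m` is in `PSamp` by definition;
2. `DKT_prob_le_two_mul`: `Pr_{𝒟^KT_m}[E] ≤ 2 · Pr_{D'_m}[E]` for every event `E` (each residue
   class mod `m` contains `≥ ⌊2^m/m⌋ ≥ 2^m/2m` of the `2^m` numerals, `Nat.count_modEq_card`; law of
   total probability over the first coin block, `uniformProb_add_eq_sum_div`; `𝒟^KT_m` as the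
   mixture `(1/m) Σₙ Uₙ`, `DKT_prob_eq_sum_div`); in particular `supp 𝒟^KT_m ⊆ supp D'_m`, which is
   all that the support-relative errorlessness of the tree's classes (`IsErrorlessFor`) needs;
3. `MINKT[n-1] ∈ NP` (`Hirahara2018_MINKTr_mem_NP_holds` of `GapMINKTDenseRandomNPProofs.lean`,
   with `1ⁿ ↦ 1ⁿ⁻¹ = List.tail`), so `(MINKT[n-1], D') ∈ DistNP ⊆ AvgP` gives an errorless heuristic
   scheme `B(w; 1ᵐ, 1ᵏ)`; the algorithm `A(w; 1ᵐ) := B(w; 1ᵐ, 1^{12(m+1)})` is polynomial-time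
   (`PolyTimeComputable.comp_holds` after the brick `⟨w, 1ᵐ⟩ ↦ ⟨w, ⟨1ᵐ, 1^{12(m+1)}⟩⟩`), errorless on
   `supp 𝒟^KT_m`, and fails with `𝒟^KT_m`-probability `≤ 2/(12(m+1)) ≤ 1/6m` for `m ≥ 1`; at the
   junk parameter `m = 0` (`𝒟^KT_0` and `D'_0` are the point mass on `([], 1⁰)`; `δ(0) = 1/0 = 0` in
   Lean) the failure probability is `0` or `1` and `≤ 1/6`, hence `0`.

No Turing machine is written here: every machine is a composition of bricks of the `FP` algebra
(`BrickAlgebra.lean`, `StringEquality.lean`, `FoldBricks.lean`, `FPStringBricks.lean`,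
`StackBricksStrings.lean`, `StackBricksArith.lean`) and of the given machines (the `AvgP` scheme)
through `PolyTimeComputable.comp_holds`.

## References

* S. Hirahara, *Non-black-box worst-case to average-case reductions within NP*, FOCS 2018,
  247–258, doi:10.1109/focs.2018.00032; full version ECCC TR18-138 rev. 1 (2019): Def. 4.13
  (`𝒟^KT`), Def. 4.14 (`MINKT[r]`), Fact 4.15, Def. 4.16 (`Avg_δP`, `AvgP`), Cor. 4.22 and its
  proof (p. 23) [Hirahara2018] (text checked: ECCC revision 1 PDF, pp. 20, 23; in the FOCS
  proceedings version this is Cor. I.2 (1 ⇒ 2), with `𝒟^u` for `𝒟^KT`, §I.C).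
* A. Bogdanov, L. Trevisan, *Average-case complexity*, Found. Trends TCS 2 (2006), Def. 2.1
  (`PSamp`), Def. 2.4 (errorless schemes) [BogdanovTrevisan2006].
* S. Arora, B. Barak, *Computational Complexity: A Modern Approach*, CUP 2009, §1.3 (closure of
  polynomial time under composition), §A.2 (finite probability) [AroraBarak2009].
-/

namespace Literature.Computability.MetaComplexity

open _root_.Computability Complexity Complexity.Classes Complexity.Nondeterministic Polynomial
open GapMINKTDecision

/-! ### The dominating sampler -/

/-- **An exact sampler dominating `𝒟^KT`, as an `FP` string function.** There is `S ∈ FP` which on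
`⟨1ᵐ, r⟩` (coins `r`, of which `2m` are used) outputs the instance `(x, 1^{m-n})` where
`n = min ((⟦r↾m⟧ mod m) + 1) m` is selected by the first `m` coins read as a binary numeral modulo
`m` (`n ∈ [m]` for `m ≥ 1`, `n = 0` for `m = 0`) and `x` consists of the next `n` coins. It is a
composition of existing bricks: `padTakeFn` (split a string at a unary length), `lenBinF`
(`1ᵐ ↦ ⟦m⟧`), `remFn` (binary remainder), `addFn`, `binToUnaryFn` (bounded binary-to-unary) and
fan-outs. (Hirahara: "it is obvious that `𝒟^KT` is efficiently samplable"; under the tree's exact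
dyadic samplers this sampler realises an ensemble dominating `𝒟^KT` within a factor `2`, see
`DKT_prob_le_two_mul`.) [cite: Hirahara2018, Def. 4.13] -/
theorem exists_sampler_mem_FP : ∃ S ∈ FP, ∀ (m : ℕ) (r : List Bool),
    S (boolPair (unaryEncodeNat m) r) =
      paramEnc (List.takeD (min (bitsToNat (List.takeD m r false) % m + 1) m) (r.drop m) false,
        m - min (bitsToNat (List.takeD m r false) % m + 1) m) := by
  -- the selected length `1ⁿ`, `n = min (⟦r↾m⟧ mod m + 1) m`
  let N : List Bool → List Bool :=
    binToUnaryFn ∘ fanoutFn Brick.fstF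
      (Brick.addFn ∘ fanoutFn
        (Brick.remFn ∘ fanoutFn (Brick.fstF ∘ Brick.padTakeFn) (Brick.lenBinF ∘ Brick.fstF))
        (fun _ => encodeNat 1))
  have hN : N ∈ FP :=
    comp_mem_FP binToUnaryFn_mem_FP (fanoutFn_mem_FP Brick.fstF_mem_FP
      (comp_mem_FP Brick.addFn_mem_FP (fanoutFn_mem_FP
        (comp_mem_FP Brick.remFn_mem_FP (fanoutFn_mem_FP
          (comp_mem_FP Brick.fstF_mem_FP Brick.padTakeFn_mem_FP)
          (comp_mem_FP Brick.lenBinF_mem_FP Brick.fstF_mem_FP)))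
        (const_mem_FP _))))
  have hN_apply : ∀ (m : ℕ) (r : List Bool), N (boolPair (unaryEncodeNat m) r) =
      List.replicate (min (bitsToNat (List.takeD m r false) % m + 1) m) true := by
    intro m r
    simp only [N, Function.comp_apply, fanoutFn_apply, Brick.fstF_boolPair, Brick.padTakeFn_boolPair,
      length_unaryEncodeNat, Brick.lenBinF_apply, Brick.remFn_boolPair, bitsToNat_encodeNat,
      Brick.addFn_boolPair, binToUnaryFn_boolPair]
  refine ⟨fanoutFn (Brick.fstF ∘ Brick.padTakeFn ∘ fanoutFn N (Brick.sndF ∘ Brick.padTakeFn))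
      (Brick.sndF ∘ Brick.padTakeFn ∘ fanoutFn N Brick.fstF),
    fanoutFn_mem_FP
      (comp_mem_FP Brick.fstF_mem_FP (comp_mem_FP Brick.padTakeFn_mem_FP
        (fanoutFn_mem_FP hN (comp_mem_FP Brick.sndF_mem_FP Brick.padTakeFn_mem_FP))))
      (comp_mem_FP Brick.sndF_mem_FP (comp_mem_FP Brick.padTakeFn_mem_FP
        (fanoutFn_mem_FP hN Brick.fstF_mem_FP))),
    fun m r => ?_⟩
  simp only [fanoutFn_apply, Function.comp_apply, hN_apply]
  simp only [Brick.padTakeFn_boolPair, Brick.fstF_boolPair, Brick.sndF_boolPair,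
    List.length_replicate, paramEnc, unaryEncodeNat_eq_replicate, List.drop_replicate]

/-! ### Probability bookkeeping: `𝒟^KT` versus the sampler -/

/-- **`𝒟^KT_m` as a mixture**, `m ≥ 1`: `Pr_{𝒟^KT_m}[E] = (1/m) Σ_{n ∈ [m]} Pr_{x ∈ {0,1}ⁿ}[(x, 1^{m-n}) ∈ E]`
(Def. 4.13 unfolded: `PMF.toOuterMeasure_bind_apply`, `PMF.toOuterMeasure_map_apply`, and the
uniform ensemble is the counting probability, `prob_uniformEnsemble`). [cite: Hirahara2018, Def. 4.13] -/
theorem DKT_prob_eq_sum_div {m : ℕ} (hm : m ≠ 0) (E : Set (List Bool)) :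
    DKT.prob m E =
      (∑ i : Fin m, uniformProb (i.1 + 1) {x | paramEnc (x, m - (i.1 + 1)) ∈ E}) / m := by
  haveI : NeZero m := ⟨hm⟩
  have hD : DKT m = (PMF.uniformOfFintype (Fin m)).bind fun i =>
      (uniformEnsemble (i.1 + 1)).map fun x => paramEnc (x, m - (i.1 + 1)) := by
    unfold DKT
    rw [dif_neg hm]
  unfold Ensemble.prob
  rw [hD, PMF.toOuterMeasure_bind_apply, tsum_fintype, ENNReal.toReal_sum (fun i _ =>
    ENNReal.mul_ne_top (PMF.apply_ne_top _ _) (by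
      rw [PMF.toOuterMeasure_apply]
      exact PMF.tsum_coe_indicator_ne_top _ _)), Finset.sum_div]
  refine Finset.sum_congr rfl fun i _ => ?_
  rw [PMF.uniformOfFintype_apply, Fintype.card_fin, PMF.toOuterMeasure_map_apply,
    ENNReal.toReal_mul, ENNReal.toReal_inv, ENNReal.toReal_natCast, div_eq_inv_mul]
  congr 1
  exact prob_uniformEnsemble (i.1 + 1) _

/-- **Law of total probability over a first block of coins.** For a string map `f` and an event
`E`: `Pr_{r ∈ {0,1}^{a+ℓ}}[f(r↾a, r⇂a) ∈ E] = 2^{-a} Σ_{u ∈ {0,1}^a} Pr_{v ∈ {0,1}^ℓ}[f(u, v) ∈ E]`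
(`{0,1}^{a+ℓ} ≃ {0,1}^a × {0,1}^ℓ` by splitting). [cite: AroraBarak2009, §A.2] -/
theorem uniformProb_add_eq_sum_div (a ℓ : ℕ) (f : List Bool → List Bool → List Bool)
    (E : Set (List Bool)) :
    uniformProb (a + ℓ) {r | f (r.take a) (r.drop a) ∈ E} =
      (∑ u : List.Vector Bool a, uniformProb ℓ {v | f u.toList v ∈ E}) / 2 ^ a := by
  classical
  let e : {r : List.Vector Bool (a + ℓ) // f (r.toList.take a) (r.toList.drop a) ∈ E} ≃
      {q : List.Vector Bool a × List.Vector Bool ℓ // f q.1.toList q.2.toList ∈ E} :=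
    { toFun := fun r =>
        ⟨(⟨r.1.toList.take a, by simp [r.1.toList_length]⟩,
          ⟨r.1.toList.drop a, by simp [r.1.toList_length]⟩), r.2⟩
      invFun := fun q =>
        ⟨⟨q.1.1.toList ++ q.1.2.toList, by simp [q.1.1.toList_length, q.1.2.toList_length]⟩, by
          change f ((q.1.1.toList ++ q.1.2.toList).take a) ((q.1.1.toList ++ q.1.2.toList).drop a) ∈ E
          rw [List.take_left' q.1.1.toList_length, List.drop_left' q.1.1.toList_length]
          exact q.2⟩
      left_inv := by
        rintro ⟨⟨r, hr⟩, h⟩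
        exact Subtype.ext (Subtype.ext (List.take_append_drop a r))
      right_inv := by
        rintro ⟨⟨⟨u, hu⟩, ⟨v, hv⟩⟩, h⟩
        refine Subtype.ext (Prod.ext (Subtype.ext ?_) (Subtype.ext ?_))
        · exact List.take_left' hu
        · exact List.drop_left' hu }
  have h1 := Fintype.card_congr e
  rw [Fintype.card_subtype, Fintype.card_subtype] at h1
  have h2 : (Finset.univ.filter fun q : List.Vector Bool a × List.Vector Bool ℓ =>
      f q.1.toList q.2.toList ∈ E).card =
      ∑ u : List.Vector Bool a, (Finset.univ.filter fun v : List.Vector Bool ℓ =>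
        f u.toList v.toList ∈ E).card := by
    rw [Finset.card_filter, Fintype.sum_prod_type]
    simp only [Finset.card_filter]
  rw [h2] at h1
  show ((Finset.univ.filter fun r : List.Vector Bool (a + ℓ) =>
      f (r.toList.take a) (r.toList.drop a) ∈ E).card : ℝ) / 2 ^ (a + ℓ) =
    (∑ u : List.Vector Bool a, ((Finset.univ.filter fun v : List.Vector Bool ℓ =>
      f u.toList v.toList ∈ E).card : ℝ) / 2 ^ ℓ) / 2 ^ a
  rw [h1]
  push_cast
  rw [Finset.sum_div, Finset.sum_div]
  refine Finset.sum_congr rfl fun u _ => ?_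
  rw [pow_add, div_div, mul_comm]

/-- **Residues are nearly equidistributed.** For `m ≥ 1` and `i < m`, at least `2^m / (2m)` of the
strings `u ∈ {0,1}^m` have `⟦u⟧ ≡ i (mod m)`: the numerals `⟦·⟧ : {0,1}^m → [0, 2^m)` are a
bijection, `#{j < 2^m | j ≡ i} ≥ ⌊2^m/m⌋` (`Nat.count_modEq_card`) and `⌊2^m/m⌋ ≥ 2^m/(2m)` as
`2^m ≥ m`. [folklore] -/
theorem two_pow_le_two_mul_card_fiber {m : ℕ} (hm : 0 < m) {i : ℕ} (hi : i < m) :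
    (2 : ℝ) ^ m ≤ 2 * m * ((Finset.univ.filter fun u : List.Vector Bool m =>
      bitsToNat u.toList % m = i).card : ℝ) := by
  classical
  let F : List.Vector Bool m → Fin (2 ^ m) := fun u =>
    ⟨bitsToNat u.toList, by simpa only [List.Vector.toList_length] using bitsToNat_lt u.toList⟩
  have hFinj : Function.Injective F := by
    intro u v h
    have h' : bitsToNat u.toList = bitsToNat v.toList := by simpa [F] using congrArg Fin.val h
    exact List.Vector.toList_injective
      (FineGrained.BruteForce.bitsToNat_injective_of_length_eq
        (by rw [u.toList_length, v.toList_length]) h')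
  have hFsurj : Function.Surjective F :=
    ((Fintype.bijective_iff_injective_and_card F).2 ⟨hFinj, by simp [card_vector]⟩).2
  have hcard : (Finset.univ.filter fun u : List.Vector Bool m => bitsToNat u.toList % m = i).card =
      Nat.count (· ≡ i [MOD m]) (2 ^ m) := by
    rw [Nat.count_eq_card_filter_range]
    refine Finset.card_bij (fun u _ => bitsToNat u.toList) (fun u hu => ?_) (fun u _ v _ h => ?_)
      (fun j hj => ?_)
    · simp only [Finset.mem_filter, Finset.mem_univ, true_and] at hu
      simp only [Finset.mem_filter, Finset.mem_range]
      exact ⟨(F u).2, by rw [Nat.ModEq, Nat.mod_eq_of_lt hi]; exact hu⟩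
    · exact hFinj (Fin.ext h)
    · simp only [Finset.mem_filter, Finset.mem_range] at hj
      obtain ⟨u, hu⟩ := hFsurj ⟨j, hj.1⟩
      have hu' : bitsToNat u.toList = j := congrArg Fin.val hu
      refine ⟨u, ?_, hu'⟩
      simp only [Finset.mem_filter, Finset.mem_univ, true_and, hu']
      have h2 := hj.2
      rw [Nat.ModEq, Nat.mod_eq_of_lt hi] at h2
      exact h2
  rw [hcard, Nat.count_modEq_card (2 ^ m) hm i]
  have h1 : m * (2 ^ m / m) + 2 ^ m % m = 2 ^ m := Nat.div_add_mod (2 ^ m) m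
  have h2 : 2 ^ m % m < m := Nat.mod_lt _ hm
  have h3 : 1 ≤ 2 ^ m / m := Nat.div_pos (Nat.lt_two_pow_self).le hm
  have key : 2 ^ m ≤ 2 * m * (2 ^ m / m + if i % m < 2 ^ m % m then 1 else 0) := by
    split_ifs <;> nlinarith [h1, h2, h3]
  exact_mod_cast key

/-- `Pr_{r ∈ {0,1}^0}[r ∈ F] = [[] ∈ F]`: the only string of length `0` is `[]`. [folklore] -/
theorem uniformProb_zero_eq_one_of_mem {F : Set (List Bool)} (h : [] ∈ F) : uniformProb 0 F = 1 :=
  le_antisymm (uniformProb_le_one _ _) <|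
    calc (1 : ℝ) = uniformProb 0 Set.univ := (uniformProb_univ 0).symm
      _ ≤ uniformProb 0 F := uniformProb_mono_of_length fun y hy _ => by
          rw [List.eq_nil_of_length_eq_zero hy]
          exact h

/-- **The sampler dominates `𝒟^KT` within a factor `2`.** If `S` is the sampler of
`exists_sampler_mem_FP`, then for every `m` and every event `E`,
`Pr_{𝒟^KT_m}[E] ≤ 2 · Pr_{r ∈ {0,1}^{2m}}[S⟨1ᵐ, r⟩ ∈ E]`. For `m = 0` both sides concern the point
mass on `([], 1⁰)`. For `m ≥ 1`: by `uniformProb_add_eq_sum_div` and `uniformProb_take_of_le` the right-hand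
probability is `2^{-m} Σ_{u ∈ {0,1}^m} q(n(u))` with `q(n) = Pr_{x ∈ {0,1}ⁿ}[(x,1^{m-n}) ∈ E]` and
`n(u) = (⟦u⟧ mod m) + 1`; grouping by the residue (`Finset.sum_fiberwise`) and
`two_pow_le_two_mul_card_fiber` give `≥ (1/2m) Σ_{n ∈ [m]} q(n) = ½ Pr_{𝒟^KT_m}[E]`
(`DKT_prob_eq_sum_div`). [cite: Hirahara2018, Def. 4.13] -/
theorem DKT_prob_le_two_mul {S : List Bool → List Bool}
    (hS : ∀ (m : ℕ) (r : List Bool), S (boolPair (unaryEncodeNat m) r) =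
      paramEnc (List.takeD (min (bitsToNat (List.takeD m r false) % m + 1) m) (r.drop m) false,
        m - min (bitsToNat (List.takeD m r false) % m + 1) m))
    (m : ℕ) (E : Set (List Bool)) :
    DKT.prob m E ≤ 2 * uniformProb (2 * m) {r | S (boolPair (unaryEncodeNat m) r) ∈ E} := by
  rcases Nat.eq_zero_or_pos m with rfl | hm
  · -- `m = 0`: point masses on `([], 1⁰)`
    have hD0 : DKT 0 = PMF.pure (paramEnc ([], 0)) := by
      unfold DKT
      rw [dif_pos rfl]
    unfold Ensemble.prob
    rw [hD0, PMF.toOuterMeasure_pure_apply]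
    split_ifs with h0
    · have h1 : uniformProb (2 * 0) {r | S (boolPair (unaryEncodeNat 0) r) ∈ E} = 1 := by
        refine uniformProb_zero_eq_one_of_mem ?_
        show S (boolPair (unaryEncodeNat 0) []) ∈ E
        rw [hS]
        simpa using h0
      rw [h1, ENNReal.toReal_one]
      norm_num
    · rw [ENNReal.toReal_zero]
      exact mul_nonneg zero_le_two (uniformProb_nonneg _ _)
  · -- `m ≥ 1`
    classical
    set q : ℕ → ℝ := fun k => uniformProb k {x | paramEnc (x, m - k) ∈ E} with hq
    have hqnn : ∀ k, 0 ≤ q k := fun k => uniformProb_nonneg _ _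
    set nsel : List Bool → ℕ := fun u => min (bitsToNat u % m + 1) m with hnsel
    have hnsel_le : ∀ u, nsel u ≤ m := fun u => min_le_right _ _
    have hnsel_eq : ∀ u, nsel u = bitsToNat u % m + 1 := fun u =>
      min_eq_left (Nat.succ_le_of_lt (Nat.mod_lt _ hm))
    -- the sampler side, rewritten on coin strings of the exact length `m + m`
    have hS' : uniformProb (2 * m) {r | S (boolPair (unaryEncodeNat m) r) ∈ E} =
        uniformProb (m + m) {r | (fun u v => paramEnc (v.take (nsel u), m - nsel u))
          (r.take m) (r.drop m) ∈ E} := by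
      rw [two_mul]
      have hpt : ∀ y : List Bool, y.length = m + m →
          (S (boolPair (unaryEncodeNat m) y) ∈ E ↔
            paramEnc ((y.drop m).take (nsel (y.take m)), m - nsel (y.take m)) ∈ E) := by
        intro y hy
        rw [hS, List.takeD_eq_take false (by omega : m ≤ y.length),
          List.takeD_eq_take false (by rw [List.length_drop]; have := hnsel_le (y.take m); omega)]
      exact le_antisymm (uniformProb_mono_of_length fun y hy h => (hpt y hy).1 h)
        (uniformProb_mono_of_length fun y hy h => (hpt y hy).2 h)
    have hu : ∀ u : List.Vector Bool m,
        uniformProb m {v | (fun u v => paramEnc (v.take (nsel u), m - nsel u)) u.toList v ∈ E} =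
          q (nsel u.toList) := fun u =>
      uniformProb_take_of_le (hnsel_le u.toList) {x | paramEnc (x, m - nsel u.toList) ∈ E}
    rw [hS', uniformProb_add_eq_sum_div m m (fun u v => paramEnc (v.take (nsel u), m - nsel u)) E,
      Finset.sum_congr rfl fun u _ => hu u]
    -- group the sum by the residue `⟦u⟧ mod m`
    have hfib : ∑ u : List.Vector Bool m, q (nsel u.toList) =
        ∑ i : Fin m, ((Finset.univ.filter fun u : List.Vector Bool m =>
          bitsToNat u.toList % m = i.1).card : ℝ) * q (i.1 + 1) := by
      rw [← Finset.sum_fiberwise Finset.univ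
        (fun u : List.Vector Bool m => (⟨bitsToNat u.toList % m, Nat.mod_lt _ hm⟩ : Fin m))
        (fun u => q (nsel u.toList))]
      refine Finset.sum_congr rfl fun i _ => ?_
      rw [Finset.sum_congr rfl (g := fun _ => q (i.1 + 1)), Finset.sum_const, nsmul_eq_mul]
      · exact congrArg (fun s : Finset (List.Vector Bool m) => (s.card : ℝ) * q (i.1 + 1))
          (Finset.filter_congr fun u _ => by simp [Fin.ext_iff])
      · intro u hu
        simp only [Finset.mem_filter, Finset.mem_univ, true_and] at hu
        have hval : bitsToNat u.toList % m = i.1 := by rw [← hu]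
        show q (nsel u.toList) = q (i.1 + 1)
        rw [hnsel_eq, hval]
    rw [hfib, DKT_prob_eq_sum_div hm.ne' E]
    -- compare termwise
    have key : (2 : ℝ) ^ m * ∑ i : Fin m, q (i.1 + 1) ≤
        2 * m * ∑ i : Fin m, ((Finset.univ.filter fun u : List.Vector Bool m =>
          bitsToNat u.toList % m = i.1).card : ℝ) * q (i.1 + 1) := by
      rw [Finset.mul_sum, Finset.mul_sum]
      refine Finset.sum_le_sum fun i _ => ?_
      calc (2 : ℝ) ^ m * q (i.1 + 1)
          ≤ (2 * m * ((Finset.univ.filter fun u : List.Vector Bool m =>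
              bitsToNat u.toList % m = i.1).card : ℝ)) * q (i.1 + 1) :=
            mul_le_mul_of_nonneg_right (two_pow_le_two_mul_card_fiber hm i.2) (hqnn _)
        _ = _ := by ring
    have hmpos : (0 : ℝ) < m := by exact_mod_cast hm
    have h2pos : (0 : ℝ) < 2 ^ m := by positivity
    show (∑ i : Fin m, q (i.1 + 1)) / m ≤ _
    rw [div_le_iff₀ hmpos]
    rw [show ∀ B : ℝ, 2 * (B / 2 ^ m) * m = (2 * m * B) / 2 ^ m from fun B => by ring,
      le_div_iff₀ h2pos]
    linarith [key]


/-! ### Cor. 4.22 (1 ⇒ 2) -/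

/-- `n ↦ n - 1` is efficiently computable in unary: `1ⁿ ↦ 1ⁿ⁻¹` is `List.tail`
(`PRelSigma.tail_mem_FP`). [folklore] -/
theorem polyTimeComputable_unary_pred :
    PolyTimeComputable unaryEncodeNat unaryEncodeNat fun n : ℕ => n - 1 := by
  obtain ⟨p, M, hM⟩ := PRelSigma.tail_mem_FP
  refine ⟨p, M, fun n => ?_⟩
  have h := hM (unaryEncodeNat n)
  have e : (unaryEncodeNat n).tail = unaryEncodeNat (n - 1) := by
    rw [unaryEncodeNat_eq_replicate, unaryEncodeNat_eq_replicate, List.tail_replicate]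
  simp only [id] at h
  rw [e] at h
  exact h

/-- The preprocessing `⟨w, 1ᵐ⟩ ↦ ⟨w, ⟨1ᵐ, 1^{12(m+1)}⟩⟩` (setting the error parameter of an
errorless heuristic scheme to `δ = 1/12(m+1)`) is polynomial-time from `paramEnc` to `schemeEnc`:
the brick `fanoutFn fstF (fanoutFn sndF (onesMulFn 12 ∘ cons 1 ∘ sndF))`.
[cite: AroraBarak2009, §1.3] -/
theorem polyTimeComputable_paramEnc_schemeEnc_twelve :
    PolyTimeComputable paramEnc schemeEnc fun q : List Bool × ℕ => (q.1, q.2, 12 * (q.2 + 1)) := by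
  obtain ⟨p, M, hM⟩ := fanoutFn_mem_FP Brick.fstF_mem_FP (fanoutFn_mem_FP Brick.sndF_mem_FP
    (comp_mem_FP (Brick.onesMulFn_mem_FP 12) (comp_mem_FP (cons_mem_FP true) Brick.sndF_mem_FP)))
  refine ⟨p, M, fun q => ?_⟩
  obtain ⟨x, m⟩ := q
  have h := hM (paramEnc (x, m))
  have e : fanoutFn Brick.fstF (fanoutFn Brick.sndF (Brick.onesMulFn 12 ∘ List.cons true ∘ Brick.sndF))
      (paramEnc (x, m)) = schemeEnc (x, m, 12 * (m + 1)) := by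
    simp only [paramEnc, schemeEnc, fanoutFn_apply, Function.comp_apply, Brick.fstF_boolPair,
      Brick.sndF_boolPair, Brick.onesMulFn, List.length_cons, List.length_replicate,
      unaryEncodeNat_eq_replicate]
  simp only [id] at h
  rw [e] at h
  exact h

/-- **Hirahara 2018, Corollary 4.22 (1 ⇒ 2), discharged** (`Hirahara2018_MINKTr_DKT_mem_AvgDeltaP`):
*if `DistNP ⊆ AvgP` then `(MINKT[r], 𝒟^KT) ∈ Avg_{1/6m}P` for `r(n) := n - 1`.* Printed proof:
"`(MINKT[r], 𝒟^KT) ∈ DistNP ⊆ AvgP ⊆ Avg_{1/6m}P`" (Fact 4.15, Def. 4.16). Here: `MINKT[n-1] ∈ NP`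
(`Hirahara2018_MINKTr_mem_NP_holds`, `polyTimeComputable_unary_pred`); the exactly samplable ensemble
`D'` of `exists_sampler_mem_FP` is in `PSamp` and dominates `𝒟^KT` within a factor `2`
(`DKT_prob_le_two_mul`), so `supp 𝒟^KT_m ⊆ supp D'_m`; the errorless heuristic scheme `B` for
`(MINKT[n-1], D') ∈ DistNP ⊆ AvgP` run with error parameter `1^{12(m+1)}`
(`polyTimeComputable_paramEnc_schemeEnc_twelve`, `PolyTimeComputable.comp_holds`) is errorless on
`supp 𝒟^KT_m` and fails with `𝒟^KT_m`-probability `≤ 2 · 1/12(m+1) ≤ 1/6m` (`m ≥ 1`; at the junk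
parameter `m = 0` the failure probability of a point mass is `0` or `1` and `≤ 1/6`, hence
`0 = 1/0`). [cite: Hirahara2018, Cor. 4.22] -/
theorem Hirahara2018_MINKTr_DKT_mem_AvgDeltaP_holds : Hirahara2018_MINKTr_DKT_mem_AvgDeltaP := by
  intro U hDist
  obtain ⟨S, hSFP, hS⟩ := exists_sampler_mem_FP
  -- the sampler as a randomized algorithm, and its (exactly samplable) ensemble `D'`
  let A : RandAlg ℕ (List Bool) := ⟨fun m r => S (boolPair (unaryEncodeNat m) r), fun n => 2 * n⟩
  let D : Ensemble := fun m => A.outputPMF unaryEncodeNat m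
  have hDsamp : D ∈ PSamp := by
    refine ⟨A, ⟨?_, 2 * X, fun n => by simp [A]⟩, fun n => rfl⟩
    obtain ⟨p, M, hM⟩ := hSFP
    exact ⟨p, M, fun q => hM (boolPair (unaryEncodeNat q.1) q.2)⟩
  have hDprob : ∀ (m : ℕ) (E : Set (List Bool)),
      D.prob m E = uniformProb (2 * m) {r | S (boolPair (unaryEncodeNat m) r) ∈ E} := by
    intro m E
    have h := pr_eq_uniformProb' A unaryEncodeNat m E
    rw [length_unaryEncodeNat] at h
    exact h
  have hdom : ∀ (m : ℕ) (E : Set (List Bool)), DKT.prob m E ≤ 2 * D.prob m E := fun m E => by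
    rw [hDprob]
    exact DKT_prob_le_two_mul hS m E
  have hsupp : ∀ (m : ℕ) (w : List Bool), w ∈ (DKT m).support → w ∈ (D m).support := by
    intro m w hw
    rw [PMF.mem_support_iff] at hw ⊢
    intro h0
    have h1 : D.prob m {w} = 0 := by
      unfold Ensemble.prob
      rw [PMF.toOuterMeasure_apply_singleton, h0, ENNReal.toReal_zero]
    have h2 : DKT.prob m {w} ≤ 0 := by simpa [h1] using hdom m {w}
    have h3 : DKT.prob m {w} = (DKT m w).toReal := by
      unfold Ensemble.prob
      rw [PMF.toOuterMeasure_apply_singleton]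
    have h4 : (DKT m w).toReal = 0 := le_antisymm (h3 ▸ h2) ENNReal.toReal_nonneg
    rw [ENNReal.toReal_eq_zero_iff] at h4
    exact h4.elim hw (PMF.apply_ne_top _ _)
  -- `(MINKT[n-1], D') ∈ DistNP ⊆ AvgP`
  have hNP : U.MINKTr (fun n => n - 1) ∈ NP :=
    Hirahara2018_MINKTr_mem_NP_holds U _ polyTimeComputable_unary_pred
  have hQ : (⟨U.MINKTr fun n => n - 1, D⟩ : DistProblem) ∈ AvgP := hDist ⟨hNP, hDsamp⟩
  obtain ⟨B, hB, hBerr, hBfail⟩ := hQ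
  -- the errorless heuristic algorithm `A(w; 1ᵐ) := B(w; 1ᵐ, 1^{12(m+1)})`
  refine ⟨fun x m => B x m (12 * (m + 1)),
    PolyTimeComputable.comp_holds hB polyTimeComputable_paramEnc_schemeEnc_twelve, ?_, ?_⟩
  · intro m x hx b hb
    exact hBerr (12 * (m + 1)) m x (hsupp m x hx) b hb
  · intro m
    change DKT.prob m {x | B x m (12 * (m + 1)) = none} ≤ 1 / (6 * (m : ℝ))
    have hfail : D.prob m {x | B x m (12 * (m + 1)) = none} ≤ 1 / (12 * ((m : ℝ) + 1)) := by
      have h := hBfail m (12 * (m + 1)) (by positivity)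
      push_cast at h
      exact h
    have hle : DKT.prob m {x | B x m (12 * (m + 1)) = none} ≤ 1 / (6 * ((m : ℝ) + 1)) :=
      calc DKT.prob m {x | B x m (12 * (m + 1)) = none}
          ≤ 2 * D.prob m {x | B x m (12 * (m + 1)) = none} := hdom _ _
        _ ≤ 2 * (1 / (12 * ((m : ℝ) + 1))) := by gcongr
        _ = 1 / (6 * ((m : ℝ) + 1)) := by field_simp; ring
    rcases Nat.eq_zero_or_pos m with rfl | hm
    · -- junk parameter: `𝒟^KT_0` is a point mass, `δ(0) = 1/0 = 0`
      have h01 : DKT.prob 0 {x | B x 0 (12 * (0 + 1)) = none} = 0 ∨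
          DKT.prob 0 {x | B x 0 (12 * (0 + 1)) = none} = 1 := by
        unfold Ensemble.prob
        rw [show DKT 0 = PMF.pure (paramEnc ([], 0)) by unfold DKT; rw [dif_pos rfl],
          PMF.toOuterMeasure_pure_apply]
        split_ifs <;> simp
      rcases h01 with h | h
      · rw [h]
        simp
      · rw [h] at hle
        norm_num at hle
    · calc DKT.prob m {x | B x m (12 * (m + 1)) = none} ≤ 1 / (6 * ((m : ℝ) + 1)) := hle
        _ ≤ 1 / (6 * (m : ℝ)) := by
          have hmpos : (0 : ℝ) < m := by exact_mod_cast hm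
          exact one_div_le_one_div_of_le (by positivity) (by linarith)

end Literature.Computability.MetaComplexity
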